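import Summits.ValiantsHypothesis.ValiantsHypothesis.Theorems.NewtonFramesTwoProductsFrameRungTwoBlockPartition

/-!
# Crux `TwoProducts` (stmt-5906), line `FrameRungTwo`: the block system of a vertex word for a GENERIC member frame — axiom (A1)

Frame-language half of the generic case of the shallow-neighbour lemma (IX) (`hIX` of `…FrameRungTwoShallowNeighbour.lean`; memo
`Cruxes/TwoProducts/memo-IX-blocks.md`).  Setting of `hIX`: dissociated frames `f`, `g`, `lexKey`-tops `T`, `T'`, common top, vertex
word `a` (`Σ a = e`), everything key-above `e` cancelled.  A BLOCK is a nonempty `F ⊆ J = {j : a j ≠ T j}` whose total gap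
`Σ_{j∈F} (T j − a j)` is one letter gap `T' p − y` (`y ≠ T' p`) of `g`; `p` is its colour.  The blocks are handed over abstractly
(`Bk`, `κ`, `yv` with their specifications `hBk`, `hκ`) so that the engine of `…FrameRungTwoRainbowBlocks.lean` (p609099) applies.

GENERICITY of the member frame `f` (hypothesis `hgen`, relative to the tops; it implies the no-parallelogram condition of g2 and says
nothing about `g`): if finitely many words `bs i` (`i ∈ s`) and a word `b` of `f` have the same total gap vector sum, then at every
coordinate `j` either `b j = T j` and no `bs i` demotes `j`, or exactly one `bs i` demotes `j`, to the letter `b j`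
("gap multisets of `f` have unique sums").

* `exists_rainbow_of_generic` — (A1∃): under `hgen`, if no `g`-word demoting ≤ 2 letters hits the vertex, every proper nonempty
  `E ⊆ J` has a rainbow block partition (read off the `g`-word of the corner `T − γ_E`, `promote_word` p602840);
* `rainbow_unique` — (A1!): two rainbow block partitions of the same `E` coincide (no genericity needed).
Honest scope: structural lemmas for ONE stub of a rung strictly below the crux `TwoProducts`; nothing here bears on `VP ≠ VNP`.
[ours; setting KPTT arXiv:1308.2286 §2, §5]
-/

set_option linter.dupNamespace false

namespace Summit.ValiantsHypothesis.ValiantsHypothesis.Theorems.NewtonFramesTwoProducts.FrameRungTwoTrinomial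

open MvPolynomial
open scoped BigOperators Classical
open Summit.ValiantsHypothesis.Theorems.DissociatedFixedK (lexKey lexKey_injective)
open Summit.ValiantsHypothesis.ValiantsHypothesis.Theorems.DissociatedFixedK.Negative (emb emb_injective)
open Summit.ValiantsHypothesis.ValiantsHypothesis.Theorems.NewtonFramesTwoProducts.FrameRungTwoBinomial
  (emb_add emb_sum apply_le_of_lexKey_le eq_T_of_not_mem_filter ne_T_of_mem_filter coeff_word exists_word prod_coeff_ne_zero)

noncomputable section

section GenericBlocks

variable {m : ℕ}

/-- A `g`-word whose sum is key-above the vertex `e` (in `l`-value) and different from `e` is cancelled, hence is an `f`-word. -/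
theorem common_fword_of_gword (l : (Fin 2 → ℝ) →L[ℝ] ℝ) (f g : Fin m → MvPolynomial (Fin 2) ℂ)
    (hinjf : ∀ a b : Fin m → (Fin 2 →₀ ℕ), (∀ j, a j ∈ (f j).support) → (∀ j, b j ∈ (f j).support) →
      ∑ j, a j = ∑ j, b j → a = b)
    (hinjg : ∀ a b : Fin m → (Fin 2 →₀ ℕ), (∀ j, a j ∈ (g j).support) → (∀ j, b j ∈ (g j).support) →
      ∑ j, a j = ∑ j, b j → a = b)
    (e : Fin 2 →₀ ℕ)
    (hzero : ∀ x : Fin 2 →₀ ℕ, x ≠ e → l (emb e) ≤ l (emb x) → coeff x (∏ j, f j) + coeff x (∏ j, g j) = 0)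
    {u : Fin m → (Fin 2 →₀ ℕ)} (hu : ∀ i, u i ∈ (g i).support) (hle : l (emb e) ≤ l (emb (∑ i, u i)))
    (hne : ∑ i, u i ≠ e) :
    ∃ v : Fin m → (Fin 2 →₀ ℕ), (∀ j, v j ∈ (f j).support) ∧ ∑ j, v j = ∑ i, u i := by
  have hcg : coeff (∑ i, u i) (∏ i, g i) ≠ 0 := by
    rw [coeff_word g hinjg u hu]; exact prod_coeff_ne_zero g u hu
  have hz := hzero _ hne hle
  have hcf : coeff (∑ i, u i) (∏ j, f j) ≠ 0 := by
    intro h; rw [h, zero_add] at hz; exact hcg hz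
  exact exists_word f hinjf (mem_support_iff.2 hcf)

/-- The `l`-value of a word sum is at most that of any of its one-letter sub-demotions (all gaps are `l`-nonnegative). -/
theorem l_sum_le_l_update (l : (Fin 2 → ℝ) →L[ℝ] ℝ) (g : Fin m → MvPolynomial (Fin 2) ℂ) (T' : Fin m → (Fin 2 →₀ ℕ))
    (hTmax' : ∀ j, ∀ x ∈ (g j).support, lexKey l x ≤ lexKey l (T' j))
    {c : Fin m → (Fin 2 →₀ ℕ)} (hc : ∀ i, c i ∈ (g i).support) (i : Fin m) :
    l (emb (∑ k, c k)) ≤ l (emb (∑ k, Function.update T' i (c i) k)) := by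
  rw [emb_sum_eq T' c, emb_sum_update T' i (c i), map_sub, map_sub, map_sum]
  apply sub_le_sub_left
  rw [← Finset.sum_erase_add _ _ (Finset.mem_univ i)]
  have hnonneg : 0 ≤ ∑ k ∈ Finset.univ.erase i, l (emb (T' k) - emb (c k)) := by
    refine Finset.sum_nonneg fun k _ => ?_
    rw [map_sub, sub_nonneg]
    exact apply_le_of_lexKey_le l (hTmax' k _ (hc k))
  linarith

/-- Two subsets of the demotion set with the same total gap are equal (dissociation of `f`, via the corners). -/
theorem eq_of_blockGap_eq (f : Fin m → MvPolynomial (Fin 2) ℂ) (T : Fin m → (Fin 2 →₀ ℕ)) (hT : ∀ j, T j ∈ (f j).support)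
    (hinjf : ∀ a b : Fin m → (Fin 2 →₀ ℕ), (∀ j, a j ∈ (f j).support) → (∀ j, b j ∈ (f j).support) →
      ∑ j, a j = ∑ j, b j → a = b)
    {a : Fin m → (Fin 2 →₀ ℕ)} (ha : ∀ j, a j ∈ (f j).support) {F F' : Finset (Fin m)}
    (hF : F ⊆ Finset.univ.filter fun i => a i ≠ T i) (hF' : F' ⊆ Finset.univ.filter fun i => a i ≠ T i)
    (hgap : ∑ j ∈ F, (emb (T j) - emb (a j)) = ∑ j ∈ F', (emb (T j) - emb (a j))) : F = F' := by
  have hb : ∀ j, (fun j => if j ∈ F then a j else T j) j = a j ∨ (fun j => if j ∈ F then a j else T j) j = T j := by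
    intro j; by_cases hj : j ∈ F <;> simp [hj]
  have hb' : ∀ j, (fun j => if j ∈ F' then a j else T j) j = a j ∨ (fun j => if j ∈ F' then a j else T j) j = T j := by
    intro j; by_cases hj : j ∈ F' <;> simp [hj]
  have heq : (fun j => if j ∈ F then a j else T j) = (fun j => if j ∈ F' then a j else T j) := by
    apply hinjf _ _ (promote_mem f T hT ha hb) (promote_mem f T hT ha hb')
    apply emb_injective
    rw [emb_sum_corner T a F, emb_sum_corner T a F', hgap]
  ext j
  have hj : (if j ∈ F then a j else T j) = (if j ∈ F' then a j else T j) := congrFun heq j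
  constructor
  · intro hjF
    by_contra hjF'
    rw [if_pos hjF, if_neg hjF'] at hj
    exact ne_T_of_mem_filter T (hF hjF) hj
  · intro hjF'
    by_contra hjF
    rw [if_neg hjF, if_pos hjF'] at hj
    exact ne_T_of_mem_filter T (hF' hjF') hj.symm

/-- The colour and the letter of a block are unique (dissociation of `g`: one-letter demotions are determined by their sums). -/
theorem block_witness_unique (g : Fin m → MvPolynomial (Fin 2) ℂ) (T' : Fin m → (Fin 2 →₀ ℕ))
    (hT' : ∀ j, T' j ∈ (g j).support)
    (hinjg : ∀ a b : Fin m → (Fin 2 →₀ ℕ), (∀ j, a j ∈ (g j).support) → (∀ j, b j ∈ (g j).support) →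
      ∑ j, a j = ∑ j, b j → a = b)
    {p p' : Fin m} {y y' : Fin 2 →₀ ℕ} (hy : y ∈ (g p).support) (hyT : y ≠ T' p) (hy' : y' ∈ (g p').support)
    (h : emb (T' p) - emb y = emb (T' p') - emb y') : p = p' ∧ y = y' := by
  have hmem : ∀ i, Function.update T' p y i ∈ (g i).support := by
    intro i; rcases eq_or_ne i p with rfl | hi
    · rw [Function.update_self]; exact hy
    · rw [Function.update_of_ne hi]; exact hT' i
  have hmem' : ∀ i, Function.update T' p' y' i ∈ (g i).support := by
    intro i; rcases eq_or_ne i p' with rfl | hi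
    · rw [Function.update_self]; exact hy'
    · rw [Function.update_of_ne hi]; exact hT' i
  have heq : Function.update T' p y = Function.update T' p' y' := by
    apply hinjg _ _ hmem hmem'
    apply emb_injective
    rw [emb_sum_update, emb_sum_update, h]
  have hpp : p = p' := by
    by_contra hpp
    have := congrFun heq p
    rw [Function.update_self, Function.update_of_ne hpp] at this
    exact hyT this
  subst hpp
  refine ⟨rfl, ?_⟩
  have := congrFun heq p
  rwa [Function.update_self, Function.update_self] at this

/-- **(A1∃) for a generic member frame.**  If no `g`-word demoting at most two letters has sum `e` (hypothesis `hno`), then every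
proper nonempty subset `E` of the demotion set has a rainbow block partition: the parts are read off the `g`-word of the corner
`T − γ_E` via `hgen`. [ours] -/
theorem exists_rainbow_of_generic (l : (Fin 2 → ℝ) →L[ℝ] ℝ) (f g : Fin m → MvPolynomial (Fin 2) ℂ)
    (T T' : Fin m → (Fin 2 →₀ ℕ))
    (hT : ∀ j, T j ∈ (f j).support) (hTmax : ∀ j, ∀ x ∈ (f j).support, lexKey l x ≤ lexKey l (T j))
    (hT' : ∀ j, T' j ∈ (g j).support) (hTmax' : ∀ j, ∀ x ∈ (g j).support, lexKey l x ≤ lexKey l (T' j))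
    (hinjf : ∀ a b : Fin m → (Fin 2 →₀ ℕ), (∀ j, a j ∈ (f j).support) → (∀ j, b j ∈ (f j).support) →
      ∑ j, a j = ∑ j, b j → a = b)
    (hinjg : ∀ a b : Fin m → (Fin 2 →₀ ℕ), (∀ j, a j ∈ (g j).support) → (∀ j, b j ∈ (g j).support) →
      ∑ j, a j = ∑ j, b j → a = b)
    (e : Fin 2 →₀ ℕ)
    (hzero : ∀ x : Fin 2 →₀ ℕ, x ≠ e → l (emb e) ≤ l (emb x) → coeff x (∏ j, f j) + coeff x (∏ j, g j) = 0)
    (htop : ∑ j, T j = ∑ j, T' j)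
    {a : Fin m → (Fin 2 →₀ ℕ)} (ha : ∀ j, a j ∈ (f j).support) (hea : ∑ j, a j = e)
    (hgen : ∀ (s : Finset (Fin m)) (bs : Fin m → Fin m → (Fin 2 →₀ ℕ)) (b : Fin m → (Fin 2 →₀ ℕ)),
      (∀ i ∈ s, ∀ j, bs i j ∈ (f j).support) → (∀ j, b j ∈ (f j).support) →
      ∑ i ∈ s, ∑ j, (emb (T j) - emb (bs i j)) = ∑ j, (emb (T j) - emb (b j)) →
      ∀ j, (b j = T j → ∀ i ∈ s, bs i j = T j) ∧ (b j ≠ T j → ∃ i ∈ s, bs i j = b j ∧ ∀ i' ∈ s, bs i' j ≠ T j → i' = i))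
    (hno : ∀ w : Fin m → (Fin 2 →₀ ℕ), (∀ i, w i ∈ (g i).support) → (Finset.univ.filter fun i => w i ≠ T' i).card ≤ 2 →
      ∑ i, w i ≠ e)
    (Bk : Finset (Finset (Fin m))) (κ : Finset (Fin m) → Fin m)
    (hBk : ∀ F, F ∈ Bk ↔ (F ⊆ Finset.univ.filter fun i => a i ≠ T i) ∧ F.Nonempty ∧ ∃ (p : Fin m) (y : Fin 2 →₀ ℕ),
      y ∈ (g p).support ∧ y ≠ T' p ∧ ∑ j ∈ F, (emb (T j) - emb (a j)) = emb (T' p) - emb y)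
    (hκ : ∀ F ∈ Bk, ∃ y : Fin 2 →₀ ℕ, y ∈ (g (κ F)).support ∧ y ≠ T' (κ F) ∧
      ∑ j ∈ F, (emb (T j) - emb (a j)) = emb (T' (κ F)) - emb y)
    (E : Finset (Fin m)) (hEJ : E ⊂ Finset.univ.filter fun i => a i ≠ T i) :
    ∃ P : Finset (Finset (Fin m)), P ⊆ Bk ∧ (∀ F ∈ P, F.Nonempty) ∧ (∀ F ∈ P, ∀ F' ∈ P, F ≠ F' → Disjoint F F') ∧
      P.biUnion id = E ∧ ∀ F ∈ P, ∀ F' ∈ P, κ F = κ F' → F = F' := by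
  -- the corner `bE` and its `g`-word `c`
  set bE : Fin m → (Fin 2 →₀ ℕ) := fun j => if j ∈ E then a j else T j with hbE
  have hb : ∀ j, bE j = a j ∨ bE j = T j := by
    intro j; by_cases hj : j ∈ E
    · left; simp only [hbE, if_pos hj]
    · right; simp only [hbE, if_neg hj]
  obtain ⟨k, hkJ, hkE⟩ := Finset.exists_of_ssubset hEJ
  have hne : bE ≠ a := by
    intro h
    have := congrFun h k
    simp only [hbE, if_neg hkE] at this
    exact ne_T_of_mem_filter T hkJ this.symm
  obtain ⟨c, hc, hsum, -⟩ := promote_word l f g T hT hTmax hinjf hinjg e hzero ha hea hb hne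
  have hbEmem : ∀ j, bE j ∈ (f j).support := promote_mem f T hT ha hb
  have hkeyE : lexKey l e < lexKey l (∑ j, bE j) :=
    (promote_cancelled l f g T hTmax e hzero ha hea hb hne).1
  set D := Finset.univ.filter (fun i => c i ≠ T' i) with hD
  -- each one-letter sub-demotion of `c` is an `f`-word `v i`
  have hv : ∀ i ∈ D, ∃ v : Fin m → (Fin 2 →₀ ℕ), (∀ j, v j ∈ (f j).support) ∧
      ∑ j, v j = ∑ k, Function.update T' i (c i) k := by
    intro i _
    have hum : ∀ k, Function.update T' i (c i) k ∈ (g k).support := by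
      intro k; rcases eq_or_ne k i with rfl | hk
      · rw [Function.update_self]; exact hc k
      · rw [Function.update_of_ne hk]; exact hT' k
    refine common_fword_of_gword l f g hinjf hinjg e hzero hum ?_ ?_
    · calc l (emb e) ≤ l (emb (∑ j, bE j)) := apply_le_of_lexKey_le l hkeyE.le
        _ = l (emb (∑ k, c k)) := by rw [hsum]
        _ ≤ _ := l_sum_le_l_update l g T' hTmax' hc i
    · apply hno _ hum
      calc (Finset.univ.filter fun k => Function.update T' i (c i) k ≠ T' k).card ≤ ({i} : Finset (Fin m)).card := by
            refine Finset.card_le_card fun k hk => ?_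
            rw [Finset.mem_filter] at hk
            rw [Finset.mem_singleton]
            by_contra hki
            exact hk.2 (by rw [Function.update_of_ne hki])
        _ ≤ 2 := by rw [Finset.card_singleton]; omega
  choose! v hvmem hvsum using hv
  -- total gap bookkeeping: `Σ_{i∈D} gaps(v i) = gaps(bE)`
  have hgapv : ∀ i ∈ D, ∑ j, (emb (T j) - emb (v i j)) = emb (T' i) - emb (c i) := by
    intro i hi
    have h1 := emb_sum_eq T (v i)
    rw [hvsum i hi, emb_sum_update T' i (c i), ← htop] at h1
    -- h1 : emb ΣT − (T'i − ci) = emb ΣT − Σ gaps(v i)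
    linear_combination h1
  have htot : ∑ i ∈ D, ∑ j, (emb (T j) - emb (v i j)) = ∑ j, (emb (T j) - emb (bE j)) := by
    rw [Finset.sum_congr rfl hgapv]
    have h2 := emb_sum_eq T bE
    have h3 := emb_sum_eq T' c
    rw [hsum, ← htop, sum_gap_eq_sum_filter T' c] at h3
    -- h2 : emb Σ bE = emb ΣT − Σ gaps bE ; h3 : emb Σ bE = emb ΣT − Σ_{D} gaps c
    linear_combination h3 - h2
  have hG := hgen D v bE (fun i hi j => hvmem i hi j) hbEmem htot
  -- blocks: `F i = {j : v i j ≠ T j}` for `i ∈ D`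
  set Fb : Fin m → Finset (Fin m) := fun i => Finset.univ.filter fun j => v i j ≠ T j with hFb
  -- on `F i`, `v i` agrees with `a`; off it, with `T`; and `F i ⊆ E`
  have hvF : ∀ i ∈ D, ∀ j, j ∈ Fb i → v i j = a j ∧ j ∈ E := by
    intro i hi j hj
    have hj' : v i j ≠ T j := by simpa [hFb] using hj
    by_cases hbj : bE j = T j
    · exact absurd ((hG j).1 hbj i hi) hj'
    · obtain ⟨i₀, hi₀, hvi₀, huniq⟩ := (hG j).2 hbj
      have : i = i₀ := huniq i hi hj'
      subst this
      have hjE : j ∈ E := by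
        by_contra hjE; apply hbj; simp only [hbE, if_neg hjE]
      refine ⟨?_, hjE⟩
      rw [hvi₀]; simp only [hbE, if_pos hjE]
  have hvF' : ∀ i ∈ D, ∀ j, j ∉ Fb i → v i j = T j := by
    intro i _ j hj
    by_contra h
    exact hj (by simpa [hFb] using h)
  -- `v i` is the corner of `F i`, so `F i` has total gap `T' i − c i`: a block of colour `i`
  have hFgap : ∀ i ∈ D, ∑ j ∈ Fb i, (emb (T j) - emb (a j)) = emb (T' i) - emb (c i) := by
    intro i hi
    rw [← hgapv i hi, sum_gap_eq_sum_filter T (v i)]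
    refine Finset.sum_congr rfl fun j hj => ?_
    rw [(hvF i hi j hj).1]
  have hFne : ∀ i ∈ D, (Fb i).Nonempty := by
    intro i hi
    by_contra h0
    rw [Finset.not_nonempty_iff_eq_empty] at h0
    have hg := hFgap i hi
    rw [h0, Finset.sum_empty] at hg
    have hci : c i ≠ T' i := by simpa [hD] using hi
    exact hci (emb_injective (sub_eq_zero.1 hg.symm)).symm
  have hFE : ∀ i ∈ D, Fb i ⊆ E := fun i hi j hj => (hvF i hi j hj).2
  have hFBk : ∀ i ∈ D, Fb i ∈ Bk := by
    intro i hi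
    rw [hBk]
    refine ⟨(hFE i hi).trans hEJ.subset, hFne i hi, i, c i, hc i, by simpa [hD] using hi, hFgap i hi⟩
  have hκF : ∀ i ∈ D, κ (Fb i) = i := by
    intro i hi
    obtain ⟨y, hy, hyT, hyg⟩ := hκ _ (hFBk i hi)
    have hci : c i ≠ T' i := by simpa [hD] using hi
    exact ((block_witness_unique g T' hT' hinjg (hc i) hci hy ((hFgap i hi).symm.trans hyg)).1).symm
  -- distinct `i` give disjoint blocks (uniqueness in `hgen`)
  have hFdisj : ∀ i ∈ D, ∀ i' ∈ D, i ≠ i' → Disjoint (Fb i) (Fb i') := by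
    intro i hi i' hi' hii'
    rw [Finset.disjoint_left]
    intro j hj hj'
    have hvj : v i j ≠ T j := by simpa [hFb] using hj
    have hvj' : v i' j ≠ T j := by simpa [hFb] using hj'
    by_cases hbj : bE j = T j
    · exact hvj ((hG j).1 hbj i hi)
    · obtain ⟨i₀, -, -, huniq⟩ := (hG j).2 hbj
      exact hii' ((huniq i hi hvj).trans (huniq i' hi' hvj').symm)
  -- every `j ∈ E` lies in some block
  have hcover : ∀ j ∈ E, ∃ i ∈ D, j ∈ Fb i := by
    intro j hjE
    have hbj : bE j ≠ T j := by
      simp only [hbE, if_pos hjE]; exact ne_T_of_mem_filter T (hEJ.subset hjE)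
    obtain ⟨i₀, hi₀, hvi₀, -⟩ := (hG j).2 hbj
    refine ⟨i₀, hi₀, ?_⟩
    simp only [hFb, Finset.mem_filter, Finset.mem_univ, true_and]
    rw [hvi₀]; exact hbj
  -- the rainbow partition `P = Fb '' D`
  refine ⟨D.image Fb, ?_, ?_, ?_, ?_, ?_⟩
  · intro F hF
    obtain ⟨i, hi, rfl⟩ := Finset.mem_image.1 hF
    exact hFBk i hi
  · intro F hF
    obtain ⟨i, hi, rfl⟩ := Finset.mem_image.1 hF
    exact hFne i hi
  · intro F hF F' hF' hFF'
    obtain ⟨i, hi, rfl⟩ := Finset.mem_image.1 hF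
    obtain ⟨i', hi', rfl⟩ := Finset.mem_image.1 hF'
    exact hFdisj i hi i' hi' fun h => hFF' (by rw [h])
  · ext j
    simp only [Finset.mem_biUnion, Finset.mem_image, id]
    constructor
    · rintro ⟨F, ⟨i, hi, rfl⟩, hj⟩
      exact hFE i hi hj
    · intro hjE
      obtain ⟨i, hi, hj⟩ := hcover j hjE
      exact ⟨Fb i, ⟨i, hi, rfl⟩, hj⟩
  · intro F hF F' hF' hk
    obtain ⟨i, hi, rfl⟩ := Finset.mem_image.1 hF
    obtain ⟨i', hi', rfl⟩ := Finset.mem_image.1 hF'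
    rw [hκF i hi, hκF i' hi'] at hk
    rw [hk]

/-- **(A1!)** Two rainbow block partitions of the same subset of the demotion set coincide (dissociation of both frames; no
genericity). [ours] -/
theorem rainbow_unique (f g : Fin m → MvPolynomial (Fin 2) ℂ) (T T' : Fin m → (Fin 2 →₀ ℕ))
    (hT : ∀ j, T j ∈ (f j).support) (hT' : ∀ j, T' j ∈ (g j).support)
    (hinjf : ∀ a b : Fin m → (Fin 2 →₀ ℕ), (∀ j, a j ∈ (f j).support) → (∀ j, b j ∈ (f j).support) →
      ∑ j, a j = ∑ j, b j → a = b)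
    (hinjg : ∀ a b : Fin m → (Fin 2 →₀ ℕ), (∀ j, a j ∈ (g j).support) → (∀ j, b j ∈ (g j).support) →
      ∑ j, a j = ∑ j, b j → a = b)
    {a : Fin m → (Fin 2 →₀ ℕ)} (ha : ∀ j, a j ∈ (f j).support)
    (Bk : Finset (Finset (Fin m))) (κ : Finset (Fin m) → Fin m) (yv : Finset (Fin m) → (Fin 2 →₀ ℕ))
    (hBkJ : ∀ F ∈ Bk, F ⊆ Finset.univ.filter fun i => a i ≠ T i)
    (hκ : ∀ F ∈ Bk, yv F ∈ (g (κ F)).support ∧ yv F ≠ T' (κ F) ∧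
      ∑ j ∈ F, (emb (T j) - emb (a j)) = emb (T' (κ F)) - emb (yv F))
    (E : Finset (Fin m)) (P P' : Finset (Finset (Fin m)))
    (hP : P ⊆ Bk ∧ (∀ F ∈ P, F.Nonempty) ∧ (∀ F ∈ P, ∀ F' ∈ P, F ≠ F' → Disjoint F F') ∧
      P.biUnion id = E ∧ ∀ F ∈ P, ∀ F' ∈ P, κ F = κ F' → F = F')
    (hP' : P' ⊆ Bk ∧ (∀ F ∈ P', F.Nonempty) ∧ (∀ F ∈ P', ∀ F' ∈ P', F ≠ F' → Disjoint F F') ∧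
      P'.biUnion id = E ∧ ∀ F ∈ P', ∀ F' ∈ P', κ F = κ F' → F = F') : P' = P := by
  -- the `g`-word of a rainbow partition and its sum
  have key : ∀ Q : Finset (Finset (Fin m)), (Q ⊆ Bk ∧ (∀ F ∈ Q, F.Nonempty) ∧
      (∀ F ∈ Q, ∀ F' ∈ Q, F ≠ F' → Disjoint F F') ∧ Q.biUnion id = E ∧ ∀ F ∈ Q, ∀ F' ∈ Q, κ F = κ F' → F = F') →
      ∃ W : Fin m → (Fin 2 →₀ ℕ), (∀ i, W i ∈ (g i).support) ∧
        emb (∑ i, W i) = emb (∑ i, T' i) - ∑ j ∈ E, (emb (T j) - emb (a j)) ∧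
        (∀ F ∈ Q, W (κ F) = yv F) ∧ (∀ i, W i ≠ T' i → ∃ F ∈ Q, κ F = i) := by
    rintro Q ⟨hQB, -, hQd, hQU, hQi⟩
    have huniq : ∀ i, (∃ F ∈ Q, κ F = i) → ∃! F, F ∈ Q ∧ κ F = i := by
      rintro i ⟨F, hF, hpF⟩
      exact ⟨F, ⟨hF, hpF⟩, fun F' ⟨hF', hpF'⟩ => hQi F' hF' F hF (hpF'.trans hpF.symm)⟩
    set W : Fin m → (Fin 2 →₀ ℕ) := fun i =>
      if h : ∃ F ∈ Q, κ F = i then yv (Finset.choose (fun F => κ F = i) Q (huniq i h)) else T' i with hW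
    have hWcol : ∀ F ∈ Q, W (κ F) = yv F := by
      intro F hF
      have h : ∃ F' ∈ Q, κ F' = κ F := ⟨F, hF, rfl⟩
      have hspec := Finset.choose_spec (fun F' => κ F' = κ F) Q (huniq (κ F) h)
      have hch : Finset.choose (fun F' => κ F' = κ F) Q (huniq (κ F) h) = F := hQi _ hspec.1 F hF hspec.2
      simp only [hW, dif_pos h]
      rw [hch]
    have hWoff : ∀ i, (¬ ∃ F ∈ Q, κ F = i) → W i = T' i := by
      intro i h; simp only [hW, dif_neg h]
    refine ⟨W, ?_, ?_, hWcol, ?_⟩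
    · intro i
      by_cases h : ∃ F ∈ Q, κ F = i
      · obtain ⟨F, hF, rfl⟩ := h
        rw [hWcol F hF]; exact (hκ F (hQB hF)).1
      · rw [hWoff i h]; exact hT' i
    · have hfilt : Finset.univ.filter (fun i => W i ≠ T' i) = Q.image κ := by
        ext i
        simp only [Finset.mem_filter, Finset.mem_univ, true_and, Finset.mem_image]
        constructor
        · intro h
          by_contra hno
          push Not at hno
          exact h (hWoff i fun ⟨F, hF, hpF⟩ => hno F hF hpF)
        · rintro ⟨F, hF, rfl⟩
          rw [hWcol F hF]
          exact (hκ F (hQB hF)).2.1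
      have hdisj' : (Q : Set (Finset (Fin m))).PairwiseDisjoint id := fun F hF F' hF' hFF' => hQd F hF F' hF' hFF'
      rw [emb_sum_eq T' W, sum_gap_eq_sum_filter T' W, hfilt, Finset.sum_image fun F hF F' hF' h => hQi F hF F' hF' h]
      congr 1
      have h1 : ∑ F ∈ Q, (emb (T' (κ F)) - emb (W (κ F))) = ∑ F ∈ Q, ∑ j ∈ F, (emb (T j) - emb (a j)) := by
        refine Finset.sum_congr rfl fun F hF => ?_
        rw [hWcol F hF, (hκ F (hQB hF)).2.2]
      rw [h1, ← hQU, Finset.sum_biUnion hdisj']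
      rfl
    · intro i hi
      by_contra h
      exact hi (hWoff i h)
  -- compare the two `g`-words
  have sub : ∀ Q Q' : Finset (Finset (Fin m)), (Q ⊆ Bk ∧ (∀ F ∈ Q, F.Nonempty) ∧
      (∀ F ∈ Q, ∀ F' ∈ Q, F ≠ F' → Disjoint F F') ∧ Q.biUnion id = E ∧ ∀ F ∈ Q, ∀ F' ∈ Q, κ F = κ F' → F = F') →
      (Q' ⊆ Bk ∧ (∀ F ∈ Q', F.Nonempty) ∧
      (∀ F ∈ Q', ∀ F' ∈ Q', F ≠ F' → Disjoint F F') ∧ Q'.biUnion id = E ∧ ∀ F ∈ Q', ∀ F' ∈ Q', κ F = κ F' → F = F') →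
      Q ⊆ Q' := by
    intro Q Q' hQ hQ' F hF
    obtain ⟨W, hWm, hWs, hWc, -⟩ := key Q hQ
    obtain ⟨W', hWm', hWs', hWc', hWd'⟩ := key Q' hQ'
    have hWW : W = W' := hinjg _ _ hWm hWm' (emb_injective (by rw [hWs, hWs']))
    have hFB : F ∈ Bk := hQ.1 hF
    obtain ⟨hy, hyT, hyg⟩ := hκ F hFB
    have hWi : W' (κ F) ≠ T' (κ F) := by rw [← hWW, hWc F hF]; exact hyT
    obtain ⟨F', hF', hk⟩ := hWd' _ hWi
    have hF'B : F' ∈ Bk := hQ'.1 hF'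
    obtain ⟨hy', hyT', hyg'⟩ := hκ F' hF'B
    -- same colour and same letter, hence same total gap, hence the same block
    have hyy : yv F' = yv F := by
      have h1 := hWc' F' hF'
      rw [hk, ← hWW, hWc F hF] at h1
      exact h1.symm
    have hFF' : F = F' := by
      apply eq_of_blockGap_eq f T hT hinjf ha (hBkJ F hFB) (hBkJ F' hF'B)
      rw [hyg, hyg', hk, hyy]
    rw [hFF']; exact hF'
  exact Finset.Subset.antisymm (sub P' P hP' hP) (sub P P' hP hP')

end GenericBlocks

end

end Summit.ValiantsHypothesis.ValiantsHypothesis.Theorems.NewtonFramesTwoProducts.FrameRungTwoTrinomial
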